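import Summits.ResolutionOfSingularities.ResolutionOfSingularities.Theorems.FrobeniusClosingSteerSwitchPlaneChart
import HarnessLib

/-!
# Crux `Steer` (stmt-ResolutionOfSingularities-16345), chain W4.1, odd branch (Par-O) of the F-B tail — brick
# (P3b): after a point step whose centre escapes the value of an older regular parameter `x` (`v(x) < v(u)`), the
# new exceptional parameter `u` and the strict transform `x / u` are PART OF A REGULAR SYSTEM OF PARAMETERS of the
# transform (Theses-free, def-free research support)

OURS (campaign `res-hironaka`, rung L ★L-G4, slot W4.1; statements about the route's own objects; they replace the
role of no printed item and are NOT statements of the manuscript under review [claim: Hironaka2017, status: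
under-review]; AI review is weaker than expert review). Seat res-D-pv-003 (gen 6) on res-L0-w41-plan-1 RULING 108c
(«(Par-O)(ii) bricks»); argument res-L0-w41-tri-1 g5 PREREG-FB v1.6 D·S6 (P2)/(P3). Companion of
`…FrobeniusClosingSteerOddBranchParity.lean` (§2 there consumes `IsRsopPart ![x_a, x_b]`; this file PRODUCES it for
the pair «new exceptional divisor, strict transform of the previous one»).

## The statement

Let `R ⊆ K` be a regular local subring dominated by the valuation ring `O`, `R₁` its local blowing up along `𝔪_R`
with respect to `O` (a POINT step, `IsLocalBlowupAlong O R 𝔪_R R₁`), `u ∈ 𝔪_R` an exceptional parameter (non-zero,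
of maximal `O`-value on `𝔪_R`) and `x ∈ R ∖ 𝔪_R²` with `v(x) < v(u)` (the centre of `O` on `R₁` lies on the strict
transform of `V(x)`: first alternative of `OddBranchParity.excParam_dichotomy`). Then `u ∈ R₁`, `x / u ∈ R₁` and
**`(u, x / u)` is part of a regular system of parameters of `R₁`** (`isRsopPart_excParam_strictTransform`): the two
boundary components `V(u)` (new exceptional divisor) and `V(x/u)` (strict transform of `V(x)`) CROSS NORMALLY at the
new centre — the `IsRsopPart` input of `OddBranchParity.isPermissibleCentre_of_two_odd` at the next point-step stage.

Proof = two tree bricks by name: res-type-062's `SwitchPlane.isRsopPart_excParam_pair` (`(u, x)` is part of a regular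
system of parameters of `R`, from `x ∉ 𝔪² + (u)` by the value inequality) and the W4.1 chain's HLOST 2.7 / de Jong 2.4
transport `exists_isRsopPart_quadraticTransform_rsopStep` (`(x_i, x_j / x_i)` is part of a regular system of
parameters of `(R[𝔪/x_i])_{𝔪_O ∩ R[𝔪/x_i]}`), with `DivisorTrigger.eq_locAtCentre_blowupRing` identifying `R₁` with
the chart of `u`. Also recorded: the version over an explicit `R' = (R[𝔪/u])_{𝔪_O ∩ R[𝔪/u]}`
(`isRsopPart_excParam_strictTransform_chart`) and the corollary that both lie in `𝔪_{R₁}` with `x / u ∉ 𝔪_{R₁}²`.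

No Theses file is imported; nothing here is a route item or a registration. [cite: DeJong1996, 2.4]
[cite: HeinzerEtAl2015, Lemma 2.7] [cite: Matsumura1987, Thm. 14.2] [cite: NovacoskiSpivakovsky2014, Def. 2.11]
-/

noncomputable section

-- `Summit.<S>.<S>.…` duplicates the summit name by design (single-problem summit).
set_option linter.dupNamespace false

open IsLocalRing

namespace Summit.ResolutionOfSingularities.ResolutionOfSingularities.Theorems.SwitchingDichotomy.OddBranchParity

open Literature.AlgebraicGeometry.Resolution

variable {K : Type} [Field K] {O : ValuationSubring K} {R : Subring K} [IsRegularLocalRing R]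

/-- **(P3b), chart form.** `R ⊆ K` regular local dominated by `O`; `u ∈ 𝔪_R`, `u ≠ 0`, of maximal value on `𝔪_R`;
`x ∈ R ∖ 𝔪_R²` with `v(x) < v(u)`; `R' = (R[𝔪_R/u])_{𝔪_O ∩ R[𝔪_R/u]}`. Then `u, x/u ∈ R'` and `(u, x/u)` is part of a
regular system of parameters of `R'`. [cite: DeJong1996, 2.4] [cite: HeinzerEtAl2015, Lemma 2.7] -/
theorem isRsopPart_excParam_strictTransform_chart (hdom : SubringDominates R O.toSubring) {u x : K}
    (huR : u ∈ R) (hum : (⟨u, huR⟩ : R) ∈ maximalIdeal R) (hu0 : u ≠ 0)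
    (humax : ∀ y : R, y ∈ maximalIdeal R → O.valuation (y : K) ≤ O.valuation u)
    (hxR : x ∈ R) (hx2 : (⟨x, hxR⟩ : R) ∉ maximalIdeal R ^ 2) (hlt : O.valuation x < O.valuation u)
    (R' : Subring K) [IsLocalRing R'] (hR' : R' = locAtCentre (blowupRing R u) O) :
    ∃ (hu' : u ∈ R') (hxu : x / u ∈ R'), IsRsopPart ![(⟨u, hu'⟩ : R'), ⟨x / u, hxu⟩] := by
  classical
  -- `(u, x)` is part of a regular system of parameters of `R` (res-type-062)
  have hc : IsRsopPart ![(⟨u, huR⟩ : R), ⟨x, hxR⟩] :=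
    SwitchPlane.isRsopPart_excParam_pair hdom huR hum hu0 humax hxR hx2 hlt
  -- complete it to a regular system of parameters `xf` with `xf 0 = u`, `xf 1 = x`
  obtain ⟨e, xf, hd, hxf, hxfz⟩ := hc.exists_rsop
  have hxf0 : xf (Fin.castAdd e 0) = ⟨u, huR⟩ := by rw [hxfz]; rfl
  have hxf1 : xf (Fin.castAdd e 1) = ⟨x, hxR⟩ := by rw [hxfz]; rfl
  have hi0 : ((xf (Fin.castAdd e 0) : R) : K) ≠ 0 := by rw [hxf0]; exact hu0
  have hmin : ∀ j, O.valuation ((xf j : R) : K) ≤ O.valuation ((xf (Fin.castAdd e 0) : R) : K) := by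
    intro j
    rw [hxf0]
    exact humax (xf j) (by rw [← hxf]; exact Ideal.subset_span ⟨j, rfl⟩)
  have hne : Fin.castAdd e (1 : Fin 2) ≠ Fin.castAdd e 0 := by
    intro h
    exact absurd (Fin.castAdd_injective _ _ h) (by decide)
  let jJ : Fin 1 → {j : Fin (2 + e) // j ≠ Fin.castAdd e 0} := fun _ => ⟨Fin.castAdd e 1, hne⟩
  have hjJ : Function.Injective jJ := Function.injective_of_subsingleton _
  have hJ : ∀ k, O.valuation (((xf (jJ k).1 : R) : K) / ((xf (Fin.castAdd e 0) : R) : K)) < 1 := by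
    intro k
    change O.valuation (((xf (Fin.castAdd e 1) : R) : K) / ((xf (Fin.castAdd e 0) : R) : K)) < 1
    rw [hxf0, hxf1]
    change O.valuation (x / u) < 1
    have hv0 : 0 < O.valuation u := pos_iff_ne_zero.mpr ((Valuation.ne_zero_iff _).mpr hu0)
    rw [map_div₀, div_lt_one₀ hv0]
    exact hlt
  have hR'' : R' = locAtCentre (blowupRing R ((xf (Fin.castAdd e 0) : R) : K)) O := by rw [hxf0]; exact hR'
  obtain ⟨z₁, hz₁, hz₁0, hz₁s⟩ :=
    exists_isRsopPart_quadraticTransform_rsopStep R O hdom hd xf hxf (Fin.castAdd e 0) hi0 hmin jJ hjJ hJ R' hR''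
  rw [hxf0] at hz₁0
  change ((z₁ 0 : R') : K) = u at hz₁0
  have hz₁1 : ((z₁ 1 : R') : K) = x / u := by
    have h := hz₁s 0
    rw [hxf0] at h
    change ((z₁ (Fin.succ 0) : R') : K) = ((xf (Fin.castAdd e 1) : R) : K) / u at h
    rw [hxf1] at h
    exact h
  have hu' : u ∈ R' := by rw [← hz₁0]; exact (z₁ 0).2
  have hxu : x / u ∈ R' := by rw [← hz₁1]; exact (z₁ 1).2
  have heq : (![(⟨u, hu'⟩ : R'), ⟨x / u, hxu⟩] : Fin 2 → R') = z₁ := by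
    funext j
    fin_cases j
    · exact Subtype.ext hz₁0.symm
    · exact Subtype.ext hz₁1.symm
  exact ⟨hu', hxu, heq ▸ hz₁⟩

/-- **(P3b) `isRsopPart_excParam_strictTransform`** (run form over `IsLocalBlowupAlong`). For the local blowing up
`R₁` of the regular local member `R ⊆ K` (dominated by `O`) along `𝔪_R` — a POINT step — an exceptional parameter
`u` (`u ∈ 𝔪_R`, `u ≠ 0`, of maximal value) and `x ∈ R ∖ 𝔪_R²` with `v(x) < v(u)`: `u, x/u ∈ R₁` and **`(u, x/u)` is
part of a regular system of parameters of `R₁`** — the new exceptional divisor `V(u)` and the strict transform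
`V(x/u)` of `V(x)` cross normally at the new centre. (res-L0-w41-tri-1 D·S6: with both divisors ODD, this is the
`IsRsopPart` input of `isPermissibleCentre_of_two_odd` at the next point-step stage.) [cite: DeJong1996, 2.4]
[cite: HeinzerEtAl2015, Lemma 2.7] [cite: NovacoskiSpivakovsky2014, Def. 2.11] -/
theorem isRsopPart_excParam_strictTransform (hdom : SubringDominates R O.toSubring) {R₁ : Subring K}
    (hbl : IsLocalBlowupAlong O R (maximalIdeal R) R₁) [IsLocalRing R₁] {u x : K}
    (huR : u ∈ R) (hum : (⟨u, huR⟩ : R) ∈ maximalIdeal R) (hu0 : u ≠ 0)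
    (humax : ∀ y : R, y ∈ maximalIdeal R → O.valuation (y : K) ≤ O.valuation u)
    (hxR : x ∈ R) (hx2 : (⟨x, hxR⟩ : R) ∉ maximalIdeal R ^ 2) (hlt : O.valuation x < O.valuation u) :
    ∃ (hu₁ : u ∈ R₁) (hxu : x / u ∈ R₁), IsRsopPart ![(⟨u, hu₁⟩ : R₁), ⟨x / u, hxu⟩] :=
  isRsopPart_excParam_strictTransform_chart hdom huR hum hu0 humax hxR hx2 hlt R₁
    (DivisorTrigger.eq_locAtCentre_blowupRing hbl huR hum hu0 humax)

/-- Corollary: in the situation of `isRsopPart_excParam_strictTransform`, both `u` and `x / u` lie in `𝔪_{R₁}` and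
NEITHER lies in `𝔪_{R₁}²` (the `IsRsopPart` API) — two regular boundary components through the new centre.
[cite: DeJong1996, 2.4] -/
theorem mem_and_not_mem_sq_excParam_strictTransform (hdom : SubringDominates R O.toSubring) {R₁ : Subring K}
    (hbl : IsLocalBlowupAlong O R (maximalIdeal R) R₁) [IsLocalRing R₁] {u x : K}
    (huR : u ∈ R) (hum : (⟨u, huR⟩ : R) ∈ maximalIdeal R) (hu0 : u ≠ 0)
    (humax : ∀ y : R, y ∈ maximalIdeal R → O.valuation (y : K) ≤ O.valuation u)
    (hxR : x ∈ R) (hx2 : (⟨x, hxR⟩ : R) ∉ maximalIdeal R ^ 2) (hlt : O.valuation x < O.valuation u) :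
    ∃ (hu₁ : u ∈ R₁) (hxu : x / u ∈ R₁),
      (⟨u, hu₁⟩ : R₁) ∈ maximalIdeal R₁ ∧ (⟨u, hu₁⟩ : R₁) ∉ maximalIdeal R₁ ^ 2 ∧
      (⟨x / u, hxu⟩ : R₁) ∈ maximalIdeal R₁ ∧ (⟨x / u, hxu⟩ : R₁) ∉ maximalIdeal R₁ ^ 2 := by
  obtain ⟨hu₁, hxu, hz⟩ := isRsopPart_excParam_strictTransform hdom hbl huR hum hu0 humax hxR hx2 hlt
  refine ⟨hu₁, hxu, ?_, ?_, ?_, ?_⟩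
  · simpa using hz.mem_maximalIdeal 0
  · simpa using hz.not_mem_sq 0
  · simpa using hz.mem_maximalIdeal 1
  · simpa using hz.not_mem_sq 1

/-- The hypothesis `x ∉ 𝔪_R²` of (P3b) in the run: an exceptional parameter of the PREVIOUS point step
`R₀ → R` (an element of `𝔪_{R₀}`, non-zero, of maximal value there) is a regular parameter of `R` — res-type-062's
`SwitchPlane.excParam_not_mem_sq_transform`, re-exported in the shape used here. [cite: HeinzerEtAl2015, Lemma 2.7] -/
theorem excParam_not_mem_sq_of_prev {R₀ : Subring K} [IsRegularLocalRing R₀]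
    (hdom₀ : SubringDominates R₀ O.toSubring) (hbl₀ : IsLocalBlowupAlong O R₀ (maximalIdeal R₀) R)
    {x : K} (hxR₀ : x ∈ R₀) (hxm : (⟨x, hxR₀⟩ : R₀) ∈ maximalIdeal R₀) (hx0 : x ≠ 0)
    (hxmax : ∀ y : R₀, y ∈ maximalIdeal R₀ → O.valuation (y : K) ≤ O.valuation x) :
    ∃ hxR : x ∈ R, (⟨x, hxR⟩ : R) ∈ maximalIdeal R ∧ (⟨x, hxR⟩ : R) ∉ maximalIdeal R ^ 2 := by
  obtain ⟨_, hxR, -, hm, hm2⟩ := SwitchPlane.excParam_not_mem_sq_transform hbl₀ hdom₀ hxR₀ hxm hx0 hxmax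
  exact ⟨hxR, hm, hm2⟩

end Summit.ResolutionOfSingularities.ResolutionOfSingularities.Theorems.SwitchingDichotomy.OddBranchParity

end
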